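import Literature.Analysis.FluidPDE.TypeIAncientMild
import Literature.Analysis.FluidPDE.ClassicalSolution
import Literature.Analysis.FluidPDE.OseenMildPressureIdentification
import Literature.Analysis.FluidPDE.GigaMiura2011ScaledAlignmentBlowupLimitHolds
import Literature.Analysis.FluidPDE.RieszPressureModConstLog
import Literature.Analysis.FluidPDE.TsaiLocalPressureSup
import Literature.Analysis.Calculus.DifferenceQuotientHolder
import HarnessLib

/-!
# The pressure of a mild bounded ancient solution: `L∞(BMO)` and logarithmic growth

Analysis/FluidPDE statement file (one NAMED FACT, unproved here; wanted by the crux `LrcModEntire` of route PoloidalWindowDoor,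
NavierStokesRegularity — cell T1 of the (TH) column, `…TwistingTHFlatSliceNoGo.false_of_flatSlice`).

A bounded ancient solution of the Navier–Stokes system that is MILD in the sense of Koch–Nadirashvili–Seregin–Šverák (the Duhamel
formula between any two negative times — the defining clause of the tree's `IsTypeIAncientMild` / of the routes' four-hypothesis class) has a
pressure `p = p_{u⊗u} ∈ L∞(−∞, t₀; BMO(ℝ³))` on every window `t ≤ t₀ < 0` (Seregin 2014, Def. 6.3 and the equivalence with the KNSS definition
stated after it, p. 109; Remark 6.4, p. 103: mildness is exactly what excludes the parasitic linear pressures `b′(t)·x` of a general bounded ancient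
solution, Remarks 6.2–6.3), and `∇p` is bounded on the window (Prop. 3.9 with `k = 0`, `l = 0`).  `BMO` plus a bounded gradient give the pointwise
growth bound `|p(t,x) − p(t,0)| ≤ K (1 + log (1 + |x|))`; the left side does not depend on the normalisation of the pressure (its gradient is
determined by the momentum equation), so the bound holds for EVERY classical pressure of the profile.

* `MildAncientPressureLogGrowth` — the fact, stated for the routes' class (`HasTypeITimeDecay`, continuity, Oseen-mild ancient, divergence-free)
  and any classical pressure `P` on `t < 0` (`IsClassicalNSSolutionOn (Iio 0) 1 0 v P`).
* `MildAncientPressureLogGrowth_holds` — its DISCHARGE from the tree, along the printed route: (i) KNSS 2009 Prop. 4.1 / (4.10) on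
  windows of the time-shifted (hence bounded) field gives uniform bounds for `∇v`, `∇²v`, hence for the quadratic source `∂ᵢ∂ⱼ(vᵢvⱼ)`, near the
  slice (`exists_norm_iteratedFDeriv_le_of_bounded_oseenMild`, `abs_pressureSource_le`); (ii) Seregin's Def. 6.3 ⇔ KNSS mildness: the classical
  pressure of a bounded Oseen-mild window is the Riesz pressure `RᵢRⱼ(vᵢvⱼ)` modulo a constant
  (`PressureNormalisation.pressure_eq_pressurePotentialMod_add_const_of_oseenMild`); (iii) Lemma 6.5's `BMO` shadow: the Riesz pressure of a bounded
  field with bounded source grows at most logarithmically (`exists_abs_pressurePotentialMod_sub_le_log`, the `log` translation modulus of `D²Γ∞`).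

## References

* G. Seregin, *Lecture Notes on Regularity Theory for the Navier–Stokes Equations*, World Scientific 2014, §6.2 Thm. 2.6 + Remarks 6.2–6.4
  (p. 102–103), §6.3 Def. 6.3 + Prop. 3.9 (p. 109–110). [Seregin2014]
* G. Koch, N. Nadirashvili, G. Seregin, V. Šverák, Acta Math. 203 (2009) 83–105 = arXiv:0709.3599, §4 p. 8. [KochNadirashviliSereginSverak2009]
-/

noncomputable section

open Set Function
open _root_.Topology

namespace Literature.Analysis.FluidPDE

/-- **Logarithmic growth of the pressure of a mild bounded ancient solution** (special case of `p_{u⊗u} ∈ L∞(−∞,t₀; BMO(ℝ³))` with `∇p`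
bounded, Seregin 2014 Def. 6.3 / Prop. 3.9, for the KNSS-mild class): for every profile of the routes' class — Type-I time decay
`‖v(t,x)‖ ≤ C/√(−t)`, continuity on `t < 0`, the Oseen–Duhamel (mild) formula between all pairs of negative times, divergence-free — and
every classical pressure `P` of it on `t < 0`, at each time `t < 0` there is `K` with `|P(t,x) − P(t,0)| ≤ K (1 + log (1 + ‖x‖))` for all `x`.
-- TODO(general form): `p_{u⊗u} ∈ L∞(−∞,t₀; BMO(ℝⁿ))`, `[p_{u⊗u}]_{B(1)} = 0`, and `sup (|∂ₜᵏ∇ˡu| + |∂ₜᵏ∇ˡ⁺¹p|) < ∞` for all `k, l`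
-- (Seregin 2014, Lemma 6.5, Def. 6.3, Prop. 3.9), for bounded mild ancient solutions in `ℝⁿ × (−∞, 0)`.
[cite: Seregin2014, §6.3 Def. 6.3 + Prop. 3.9 (p. 109–110); Remark 6.4 (p. 103)] -/
def MildAncientPressureLogGrowth : Prop :=
  ∀ (C : ℝ) (v : ℝ → EuclideanSpace ℝ (Fin 3) → EuclideanSpace ℝ (Fin 3)) (P : ℝ → EuclideanSpace ℝ (Fin 3) → ℝ),
    HasTypeITimeDecay C v →
    ContinuousOn (Function.uncurry v) (Set.Iio (0 : ℝ) ×ˢ Set.univ) →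
    (∀ s t : ℝ, s < t → t < 0 → ∀ x, v t x =
      UnboundedOperators.heatExtension (v s) (t - s) x - oseenDuhamel 1 s v v t x) →
    (∀ t < 0, VectorCalculus.IsDivFree (v t)) →
    IsClassicalNSSolutionOn (Set.Iio 0) 1 0 v P →
    ∀ t < 0, ∃ K : ℝ, ∀ x : EuclideanSpace ℝ (Fin 3), |P t x - P t 0| ≤ K * (1 + Real.log (1 + ‖x‖))

/-! ### Discharge -/

section Discharge

open MeasureTheory Metric Filter

-- nested operator types (`fderiv ℝ (fderiv ℝ v) x`)
set_option maxSynthPendingDepth 3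

/-- Window bounds for the first two derivatives of a profile of the class near a slice `t < 0`: on `(9t/8, 7t/8) ∋ t` one has
`‖∇v(σ,·)‖ ≤ K₁`, `‖∇²v(σ,·)‖ ≤ K₂` — KNSS 2009 Prop. 4.1 / (4.10) (`exists_norm_iteratedFDeriv_le_of_bounded_oseenMild`) applied to the
time-shifted field `τ ↦ v(τ + t/2)`, which is bounded by `C/√(−t/2)` on `τ < 0` (private step of the discharge).
[cite: KochNadirashviliSereginSverak2009, §4 Prop. 4.1 with (4.10) (arXiv:0709.3599 p. 8)] -/
private theorem exists_window_derivative_bounds {C : ℝ} {v : ℝ → EuclideanSpace ℝ (Fin 3) → EuclideanSpace ℝ (Fin 3)}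
    (hdec : HasTypeITimeDecay C v)
    (hcont : ContinuousOn (Function.uncurry v) (Set.Iio (0 : ℝ) ×ˢ Set.univ))
    (hmild : ∀ s t : ℝ, s < t → t < 0 → ∀ x, v t x =
      UnboundedOperators.heatExtension (v s) (t - s) x - oseenDuhamel 1 s v v t x)
    (hwdiv : ∀ t < 0, IsWeaklyDivFree (v t)) {t : ℝ} (ht : t < 0) (k : ℕ) :
    ∃ K : ℝ, ∀ σ ∈ Ioo (9 * t / 8) (7 * t / 8), ∀ x, ‖iteratedFDeriv ℝ k (v σ) x‖ ≤ K := by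
  have hC0 : 0 ≤ C := by
    have h := hdec (-1) (by norm_num) 0
    rw [neg_neg, Real.sqrt_one, div_one] at h
    exact (norm_nonneg _).trans h
  -- the shifted field
  set b : ℝ := t / 2 with hb
  have hb0 : b < 0 := by rw [hb]; linarith
  set M : ℝ := C / Real.sqrt (-b) with hM
  set V : ℝ → EuclideanSpace ℝ (Fin 3) → EuclideanSpace ℝ (Fin 3) := fun τ => v (τ + b) with hV
  have hVneg : ∀ τ : ℝ, τ < 0 → τ + b < 0 := fun τ hτ => by linarith
  have hVc : ContinuousOn (Function.uncurry V) (Ioo t 0 ×ˢ univ) := by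
    have hmap : Continuous fun q : ℝ × EuclideanSpace ℝ (Fin 3) => (q.1 + b, q.2) :=
      (continuous_fst.add continuous_const).prodMk continuous_snd
    have hinto : MapsTo (fun q : ℝ × EuclideanSpace ℝ (Fin 3) => (q.1 + b, q.2)) (Ioo t 0 ×ˢ univ)
        (Set.Iio (0 : ℝ) ×ˢ Set.univ) := fun q hq => ⟨hVneg q.1 hq.1.2, mem_univ _⟩
    exact (hcont.comp hmap.continuousOn hinto).congr fun q _ => rfl
  have hVdiv : ∀ τ ∈ Ioo t 0, IsWeaklyDivFree (V τ) := fun τ hτ => hwdiv (τ + b) (hVneg τ hτ.2)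
  have hVmild : ∀ s' t' : ℝ, t < s' → s' < t' → t' < 0 → ∀ x,
      V t' x = UnboundedOperators.heatExtension (V s') (t' - s') x - oseenDuhamel 1 s' V V t' x := by
    intro s' t' _ hst ht' x
    have h := hmild (s' + b) (t' + b) (by linarith) (hVneg t' ht') x
    rw [show t' + b - (s' + b) = t' - s' by ring] at h
    rw [show V t' x = v (t' + b) x from rfl, h, oseenDuhamel_translate 1 s' b v v t' x]
  have hVbd : ∀ τ ∈ Ioo t 0, ∀ x, ‖V τ x‖ ≤ M := by
    intro τ hτ x
    have hτb : τ + b < 0 := hVneg τ hτ.2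
    refine (hdec (τ + b) hτb x).trans ?_
    rw [hM]
    exact div_le_div_of_nonneg_left hC0 (Real.sqrt_pos.2 (by linarith))
      (Real.sqrt_le_sqrt (by linarith [hτ.2]))
  -- KNSS (4.10) on the window `[a + δ, a + ℓ) = [5t/8, 3t/8)`, `a = 3t/4`
  obtain ⟨K, hK⟩ := exists_norm_iteratedFDeriv_le_of_bounded_oseenMild M k (ℓ := -(3 * t) / 8)
    (δ := -t / 8) (by linarith) (by linarith)
  have hwin := hK (A := t) (a := 3 * t / 4) (u := V) (by linarith) (by linarith) hVc hVdiv hVmild hVbd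
  refine ⟨K, fun σ hσ x => ?_⟩
  have hτ : σ - b ∈ Ico (3 * t / 4 + -t / 8) (3 * t / 4 + -(3 * t) / 8) := by
    rw [hb]; constructor <;> [have := hσ.1; have := hσ.2] <;> linarith
  have h := hwin (σ - b) hτ x
  have hslice : V (σ - b) = v σ := by
    funext y; show v (σ - b + b) y = v σ y; rw [sub_add_cancel]
  rwa [hslice] at h

/-- **Discharge of `MildAncientPressureLogGrowth`** (Seregin 2014, Def. 6.3 with Remark 6.4 and Lemma 6.5; KNSS 2009, §4): fix `t < 0`.
On the window `(9t/8, 7t/8) ∋ t` the profile is bounded by `N = C/√(−7t/8)`, Oseen-mild, and — by KNSS Prop. 4.1 on the shifted field — has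
`‖∇v‖ ≤ K₁`, `‖∇²v‖ ≤ K₂`, so its quadratic source is bounded, `|∂ᵢ∂ⱼ(vᵢvⱼ)| ≤ N_G` (`abs_pressureSource_le`); hence every classical pressure is
`P(t,·) = Q̃[v(t)] + c` with `Q̃` the Riesz pressure modulo constants (`pressure_eq_pressurePotentialMod_add_const_of_oseenMild`: the KNSS and
Seregin–Šverák notions of mildness agree, no drift `b′(t)·x`), and `|Q̃(x) − Q̃(0)| ≤ 2N_G‖Γ₀‖₁ + A N²(1 + log(1+|x|))`
(`exists_abs_pressurePotentialMod_sub_le_log`, Lemma 6.5's `‖q_F‖_BMO ≤ c‖F‖_∞` read through the `log` translation modulus of `D²Γ∞`).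
[cite: Seregin2014, §6.3 Def. 6.3 + Remark 6.4 (p. 103, 109); §6.2 Lemma 6.5] -/
theorem MildAncientPressureLogGrowth_holds : MildAncientPressureLogGrowth := by
  intro C v P hdec hcont hmild hdiv hcl t ht
  have hC0 : 0 ≤ C := by
    have h := hdec (-1) (by norm_num) 0
    rw [neg_neg, Real.sqrt_one, div_one] at h
    exact (norm_nonneg _).trans h
  -- slices are smooth and (weakly) divergence free
  have hsm := fun (τ : ℝ) (hτ : τ < 0) => hcl.contDiff_velocity (t := τ) hτ
  have hwdiv : ∀ τ < 0, IsWeaklyDivFree (v τ) := fun τ hτ =>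
    VectorCalculus.IsDivFree.isWeaklyDivFree_holds (hdiv τ hτ) (contDiff_infty.1 (hsm τ hτ) 1)
  -- the window `(t₁, t₂) = (9t/8, 7t/8) ∋ t`
  set t₁ : ℝ := 9 * t / 8 with ht₁
  set t₂ : ℝ := 7 * t / 8 with ht₂
  have ht₂0 : t₂ < 0 := by rw [ht₂]; linarith
  have htI : t ∈ Ioo t₁ t₂ := by rw [ht₁, ht₂]; constructor <;> linarith
  have hIsub : Ioo t₁ t₂ ⊆ Set.Iio (0 : ℝ) := fun σ hσ => hσ.2.trans ht₂0
  -- velocity bound on the window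
  set N : ℝ := C / Real.sqrt (-t₂) with hN
  have hN0 : 0 ≤ N := by rw [hN]; exact div_nonneg hC0 (Real.sqrt_nonneg _)
  have hNb : ∀ σ ∈ Ioo t₁ t₂, ∀ x, ‖v σ x‖ ≤ N := by
    intro σ hσ x
    refine (hdec σ (hIsub hσ) x).trans ?_
    rw [hN]
    exact div_le_div_of_nonneg_left hC0 (Real.sqrt_pos.2 (by linarith))
      (Real.sqrt_le_sqrt (by linarith [hσ.2]))
  -- derivative bounds on the window (KNSS Prop. 4.1 on the shifted field)
  obtain ⟨K₁, hK₁⟩ := exists_window_derivative_bounds hdec hcont hmild hwdiv ht 1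
  obtain ⟨K₂, hK₂⟩ := exists_window_derivative_bounds hdec hcont hmild hwdiv ht 2
  have hK₁0 : 0 ≤ K₁ := (norm_nonneg _).trans (hK₁ t htI 0)
  have hK₂0 : 0 ≤ K₂ := (norm_nonneg _).trans (hK₂ t htI 0)
  -- the quadratic source is bounded on the window
  set T : ℝ := ‖(traceCLM : (EuclideanSpace ℝ (Fin 3) →L[ℝ] EuclideanSpace ℝ (Fin 3)) →L[ℝ] ℝ)‖ with hT
  have hT0 : 0 ≤ T := by rw [hT]; exact norm_nonneg _
  set NG : ℝ := 2 * T * K₂ * N + (T + T ^ 2) * K₁ ^ 2 with hNG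
  have hNG0 : 0 ≤ NG := by rw [hNG]; positivity
  have hG : ∀ σ ∈ Ioo t₁ t₂, ∀ x, |pressureSource (v σ) x| ≤ NG := by
    intro σ hσ x
    have hσ0 : σ < 0 := hIsub hσ
    have hcd : ContDiff ℝ 2 (v σ) := contDiff_infty.1 (hsm σ hσ0) 2
    have h := abs_pressureSource_le hcd x
    have hD1 : ‖fderiv ℝ (v σ) x‖ ≤ K₁ := by
      rw [← norm_iteratedFDeriv_one]; exact hK₁ σ hσ x
    have hD2 : ‖fderiv ℝ (fderiv ℝ (v σ)) x‖ ≤ K₂ :=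
      (Literature.Analysis.Calculus.norm_fderiv_fderiv_le_norm_iteratedFDeriv_two (v σ) x).trans (hK₂ σ hσ x)
    have hv := hNb σ hσ x
    have A1 : 2 * T * ‖fderiv ℝ (fderiv ℝ (v σ)) x‖ * ‖v σ x‖ ≤ 2 * T * K₂ * N := by
      have h1 : 2 * T * ‖fderiv ℝ (fderiv ℝ (v σ)) x‖ ≤ 2 * T * K₂ :=
        mul_le_mul_of_nonneg_left hD2 (by positivity)
      exact mul_le_mul h1 hv (norm_nonneg _) (by positivity)
    have A2 : (T + T ^ 2) * ‖fderiv ℝ (v σ) x‖ ^ 2 ≤ (T + T ^ 2) * K₁ ^ 2 :=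
      mul_le_mul_of_nonneg_left (pow_le_pow_left₀ (norm_nonneg _) hD1 2) (by positivity)
    rw [hNG]
    exact h.trans (add_le_add A1 A2)
  -- Oseen-mild on the window; classical on the window
  have hmildW : ∀ s ∈ Ioo t₁ t₂, ∀ t' ∈ Ioo t₁ t₂, s < t' → ∀ x,
      v t' x = UnboundedOperators.heatExtension (v s) (t' - s) x - oseenDuhamel 1 s v v t' x :=
    fun s _ t' ht' hst x => hmild s t' hst (hIsub ht') x
  have hclW : IsClassicalNSSolutionOn (Ioo t₁ t₂) 1 0 v P := hcl.mono hIsub (uniqueDiffOn_Ioo t₁ t₂)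
  -- the pressure is the Riesz pressure modulo a constant
  obtain ⟨c, hc⟩ := PressureNormalisation.pressure_eq_pressurePotentialMod_add_const_of_oseenMild hclW hNb hG
    hmildW 0 htI
  -- logarithmic growth of the Riesz pressure modulo constants
  obtain ⟨A, hA0, hA⟩ := exists_abs_pressurePotentialMod_sub_le_log
  set I : ℝ := ∫ z, |newtonNear 1 2 z| with hI
  have hI0 : 0 ≤ I := by rw [hI]; exact integral_nonneg fun z => abs_nonneg _
  have hcontv : Continuous (v t) := (hsm t ht).continuous
  refine ⟨2 * NG * I + A * N ^ 2, fun x => ?_⟩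
  have hL0 : 0 ≤ Real.log (1 + ‖x‖) := Real.log_nonneg (by linarith [norm_nonneg x])
  have key := hA (v t) hcontv N NG (fun y => hNb t htI y) (fun y => hG t htI y) 0 x 0
  rw [sub_zero] at key
  calc |P t x - P t 0|
      = |pressurePotentialMod 0 (v t) x - pressurePotentialMod 0 (v t) 0| := by
        rw [hc x, hc 0]; ring_nf
    _ ≤ 2 * NG * I + A * N ^ 2 * (1 + Real.log (1 + ‖x‖)) := key
    _ ≤ (2 * NG * I + A * N ^ 2) * (1 + Real.log (1 + ‖x‖)) := by
        have h1 : 0 ≤ 2 * NG * I := by positivity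
        nlinarith

end Discharge

end Literature.Analysis.FluidPDE

end
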